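import Summits.Ventures.HodgeRepro.Night1ProductWeilHodge

/-!
# The `σ`-lines are the eigenlines of the `K`-action: a vector of the Weil space on which every `f ∈ K`
acts by the scalar `σ_g(f)` is a multiple of the `g`-line — the lines are canonical

Blind re-derivation cell `pub-hodge-repro`, seat `night-1` (gen 5, eleventh file).  Imports night-1's
`Night1ProductWeilHodge` (the coefficient calculus `eq_sum_lineDual_smul` / `lineDual_sum_smul_weilWedgeProd`)
and, through it, `Night1ProductWeilRational` (the `K`-action `fieldAct K φ₀ e f` on the Weil space, with
`fieldAct_weilWedgeProd : fieldAct f (e_g) = φ₀(g f) • e_g`).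

Milne 2020 §2.1 (paper:arxiv-2010.08857 p0004:L3–10): `W_E(A)` is a one-dimensional `E`-vector space, so
`W_E(A) ⊗ ℂ = ⊕_{σ : E → ℂ} W_σ` with `E` acting on `W_σ` through `σ` — the `σ`-lines are the isotypic
components of the `E`-action, not an artefact of coordinates.  On the `G`-set model (`E = K` Galois, base
embedding `φ₀`, `σ_g = φ₀ ∘ g`):

* `lineDual_fieldAct` — the `K`-action is diagonal in the line basis: `⟨e^*_τ, fieldAct f ω⟩ = φ₀(τ f) ⟨e^*_τ, ω⟩`
  on the Weil space;
* **`fieldAct_eq_smul_iff`** — for `ω` in the Weil space, `fieldAct f ω = φ₀(g f) • ω` for every `f ∈ K`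
  IFF `ω` is a multiple of the `g`-line (distinct automorphisms `τ ≠ g` are separated by some `f`, and
  `φ₀` is injective, so every other coefficient vanishes);
* `eigenline_eq_span` — the simultaneous `σ_g`-eigenspace of the `K`-action inside the Weil space is the
  span of the `g`-line.

Nothing geometric is built; every statement is about coordinate wedges on the finite `G`-set `ι × G`.
Nothing here says anything about the status of the Hodge conjecture for CM abelian varieties, which is
NOT proved.
-/

set_option autoImplicit false

open Finset Module
open scoped Classical

namespace HodgeRepro.RouteC

open CMHodge CMHodgeOn

section Eigenline

variable (K : Type*) [Field K] [NumberField K] [IsGalois ℚ K] (φ₀ : K →+* ℂ)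
variable {ι : Type*} [Fintype ι] [DecidableEq ι]

omit [IsGalois ℚ K] [Fintype ι] in
/-- The `K`-action on a combination of lines: each coefficient is multiplied by `φ₀(τ f)` (`k ≥ 1`). -/
theorem fieldAct_sum_smul_weilWedgeProd {k : ℕ} (hk : 0 < k) (e : Fin (2 * k) ≃ ι) (f : K)
    (a : (K ≃ₐ[ℚ] K) → ℂ) :
    fieldAct K φ₀ e f (∑ τ, a τ • weilWedgeProd e τ) =
      ∑ τ, (a τ * φ₀ (τ f)) • weilWedgeProd e τ := by
  simp only [map_sum, map_smul, fieldAct_weilWedgeProd K φ₀ hk, smul_smul]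

omit [IsGalois ℚ K] [Fintype ι] in
/-- **The `K`-action is diagonal in the line basis**: on the Weil space,
`⟨e^*_τ, fieldAct f ω⟩ = φ₀(τ f) ⟨e^*_τ, ω⟩` (`k ≥ 1`). -/
theorem lineDual_fieldAct {k : ℕ} (hk : 0 < k) (e : Fin (2 * k) ≃ ι) (f : K)
    {ω : ⋀[ℂ]^(2 * k) ((ι × (K ≃ₐ[ℚ] K)) → ℂ)} (hω : ω ∈ weilSpaceProd (K ≃ₐ[ℚ] K) k e)
    (τ : K ≃ₐ[ℚ] K) : lineDual e τ (fieldAct K φ₀ e f ω) = φ₀ (τ f) * lineDual e τ ω := by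
  conv_lhs => rw [eq_sum_lineDual_smul hk e hω, fieldAct_sum_smul_weilWedgeProd K φ₀ hk e f,
    lineDual_sum_smul_weilWedgeProd hk e _ τ]
  ring

omit [IsGalois ℚ K] [Fintype ι] in
/-- Two distinct automorphisms are separated by some element of `K`. -/
theorem exists_apply_ne_of_ne {g τ : K ≃ₐ[ℚ] K} (h : τ ≠ g) : ∃ f : K, τ f ≠ g f := by
  by_contra hcon
  push Not at hcon
  exact h (AlgEquiv.ext hcon)

omit [IsGalois ℚ K] [Fintype ι] in
/-- **The `σ_g`-eigenvectors of the `K`-action in the Weil space are the multiples of the `g`-line**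
(`k ≥ 1`): `fieldAct f ω = φ₀(g f) • ω` for every `f ∈ K` iff `ω = a • e_g` for some `a ∈ ℂ`. -/
theorem fieldAct_eq_smul_iff {k : ℕ} (hk : 0 < k) (e : Fin (2 * k) ≃ ι) (g : K ≃ₐ[ℚ] K)
    {ω : ⋀[ℂ]^(2 * k) ((ι × (K ≃ₐ[ℚ] K)) → ℂ)} (hω : ω ∈ weilSpaceProd (K ≃ₐ[ℚ] K) k e) :
    (∀ f : K, fieldAct K φ₀ e f ω = φ₀ (g f) • ω) ↔ ∃ a : ℂ, ω = a • weilWedgeProd e g := by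
  constructor
  · intro h
    refine ⟨lineDual e g ω, ?_⟩
    -- every other coefficient vanishes
    have hzero : ∀ τ : K ≃ₐ[ℚ] K, τ ≠ g → lineDual e τ ω = 0 := by
      intro τ hτ
      obtain ⟨f, hf⟩ := exists_apply_ne_of_ne K hτ
      have h1 := congrArg (lineDual e τ) (h f)
      rw [lineDual_fieldAct K φ₀ hk e f hω τ, map_smul, smul_eq_mul] at h1
      have h2 : (φ₀ (τ f) - φ₀ (g f)) * lineDual e τ ω = 0 := by
        rw [sub_mul, h1, sub_self]
      rcases mul_eq_zero.1 h2 with h3 | h3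
      · exact absurd (φ₀.injective (sub_eq_zero.1 h3)) hf
      · exact h3
    conv_lhs => rw [eq_sum_lineDual_smul hk e hω]
    rw [Finset.sum_eq_single g]
    · intro τ _ hτ
      rw [hzero τ hτ, zero_smul]
    · intro hg
      exact absurd (Finset.mem_univ g) hg
  · rintro ⟨a, rfl⟩ f
    rw [map_smul, fieldAct_weilWedgeProd K φ₀ hk, smul_comm]

omit [IsGalois ℚ K] [Fintype ι] in
/-- **The eigenline**: the simultaneous `σ_g`-eigenspace of the `K`-action inside the Weil space is the
span of the `g`-line (`k ≥ 1`) — the lines are canonical. -/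
theorem eigenline_eq_span {k : ℕ} (hk : 0 < k) (e : Fin (2 * k) ≃ ι) (g : K ≃ₐ[ℚ] K) :
    {ω : ⋀[ℂ]^(2 * k) ((ι × (K ≃ₐ[ℚ] K)) → ℂ) |
        ω ∈ weilSpaceProd (K ≃ₐ[ℚ] K) k e ∧ ∀ f : K, fieldAct K φ₀ e f ω = φ₀ (g f) • ω} =
      ↑(Submodule.span ℂ {weilWedgeProd e g}) := by
  ext ω
  simp only [Set.mem_setOf_eq, SetLike.mem_coe, Submodule.mem_span_singleton]
  constructor
  · rintro ⟨hω, h⟩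
    obtain ⟨a, ha⟩ := (fieldAct_eq_smul_iff K φ₀ hk e g hω).1 h
    exact ⟨a, ha.symm⟩
  · rintro ⟨a, rfl⟩
    refine ⟨Submodule.smul_mem _ _ (weilWedgeProd_mem_weilSpaceProd k e g), ?_⟩
    exact (fieldAct_eq_smul_iff K φ₀ hk e g
      (Submodule.smul_mem _ _ (weilWedgeProd_mem_weilSpaceProd k e g))).2 ⟨a, rfl⟩

end Eigenline

end HodgeRepro.RouteC
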